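import Literature.Analysis.FluidPDE.BoundedWeakDriftLimit
import Literature.Analysis.FluidPDE.KNSSTypeIRateLiouvilleDescent
import Literature.Analysis.FluidPDE.KNSSLiouvillePlanarHolds
import Literature.Analysis.FluidPDE.KNSSTypeIRateLimit
import Literature.Analysis.FluidPDE.KNSSThm52Assembly
import Literature.Analysis.FluidPDE.KNSSRegularityGluing
import Literature.Analysis.FluidPDE.BoundedWeakTranslate
import Literature.Analysis.FluidPDE.LeiZhang2011ZoomIn
import Literature.Analysis.FluidPDE.KNSSTypeIIZoomIn
import Literature.Analysis.FluidPDE.AxisymmetricVorticityTransport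
import Literature.Analysis.FluidPDE.LeiZhang2011BlowupCase2
import HarnessLib

/-!
# Ancient axisymmetric solutions with bounded swirl flatten far from the axis (velocity part)

Analysis/FluidPDE **proofs file** (theorems only: no definitions, no named facts, no `sorry`) on
the discharge path of the named fact `Literature.Analysis.FluidPDE.leiRenZhang2019_sliding`
(Z. Lei, X. Ren, Q. S. Zhang, arXiv:1902.11229, §5 **Lemma 5.1** "Sliding Property", proved
there on p. 13 "for completeness" and attributed to Lei–Zhang: a bounded ancient axisymmetric
mild solution with `|Γ| = |r v_θ| ≤ C` converges to constant vectors on parabolic cubes sliding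
to spatial infinity away from the axis; the same receding-axis compactness argument is Case 2 of
the proof of Theorem 1.4 of Z. Lei, Q. S. Zhang, J. Funct. Anal. 261 (2011) 2323–2345 =
arXiv:1011.5066, §4, pp. 12–13, already rendered in the tree as `LeiZhang2011RegularityCase2`).
The printed proof (LRZ19 p. 13): were the oscillation of `v` on `B(x_k, R)` at times `t_k` bounded
below along `r(x_k) → ∞`, the translates `v(t_k + s, x_k + y)` would converge (uniform gradient
bounds, Arzelà–Ascoli) to a bounded ancient solution `w`; the symmetry axes recede, so `w` is
invariant along `e_θ`, and `|w_θ| ≲ C / r_k → 0`; "by the Liouville theorem for 2D bounded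
ancient solutions in [KNSS], `w` is constant" — contradiction.

This file carries the argument out for the **regular representative** `U + β(t) e_z` of such a
solution (the output of KNSS 2009 §4 in the tree's form `KNSS2009_regularity_axisymmetric_swirl`:
`U` bounded, Lipschitz in `x` and `t`, with axisymmetric weakly divergence-free slices, `β`
merely bounded measurable — the parasitic axial drift), in the bounded weak class of KNSS §4 (ii):

* `IsBoundedWeakNSSolutionOn.planarProj_trace_of_lineInvariant` — the descent lemma
  `IsBoundedWeakNSSolutionOn.planarTrace_of_lineInvariant` (`KNSSTypeIRateLiouvilleDescent`)
  with joint continuity weakened to **continuity of the slices plus measurability of the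
  trace** (the only two uses of joint continuity in that proof), so that fields
  `W(t, x) + c(t) e_z` with `W` continuous and `c` measurable are covered;
* `planar_apply_eq_of_lineInvariant_add_drift` — **KNSS Theorem 5.1 for `W + c(t) e_z`**: if
  `W + c(t)e_z` is a bounded weak ancient solution, `W` jointly continuous, invariant under
  `x ↦ x + δe₁` and with weakly divergence-free slices, `c` measurable, then the planar
  components `W₀(t, ·)`, `W₂(t, ·)` are constant in space for every `t < 0`
  (`KNSS2009_liouville_planar_holds`; the drift is absorbed in the constant `b(t)` of Thm 5.1);
* `abs_apply_one_le_of_abs_swirl_le` — `|v₁(x)| ≤ (C₁ + |x₁| M) / x₀` on `{x₀ > 0}` when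
  `|Γ| ≤ C₁`, `‖v‖ ≤ M` (LZ11 p. 12: "`|v^θ(t, y)| ≲ 1 / r_k`");
* `farField_velocity_osc_of_axisymmetric_add_drift` — **the velocity half of the sliding
  property for the representative**: for every `R, ε > 0` there is `ρ` with
  `‖U(t, x) − U(t, y)‖ ≤ ε` for all `t < 0` and `x, y ∈ B(x₀, R)` whenever `r(x₀) ≥ ρ`. Proof
  by contradiction as printed, in the frame of the tree's Case 2 of LZ11 Thm 1.4
  (`LeiZhang2011RegularityCase2`): bad centres are rotated onto the meridian half-plane
  (`exists_rotZ_eq_single_add_smul`); the translates `V_n(s, y) = U(t_n + s, x_n + y)` are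
  uniformly Lipschitz on `[A_n + 1, 0] × ℝ³`, `A_n → −∞`, so a subsequence converges pointwise
  to a Lipschitz `W` (`lipschitzWith_clamp`, `exists_strictMono_tendsto_of_lipschitzWith`), and
  along a further subsequence the primitives of the translated drifts converge
  (`exists_strictMono_tendsto_primitive`); by `isBoundedWeakNSSolutionOn_add_smul_of_tendsto`
  (`BoundedWeakDriftLimit`) `W + B'(t)e_z` is a bounded weak ancient solution; the axes recede
  (`eq_of_tendstoLocallyUniformly_of_rot_about`), so `W(t, ·)` is `e₁`-invariant, and
  `W₁ ≡ 0` by the swirl bound; hence `W(t, ·)` is constant for `t < 0`, and at `t = 0` by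
  continuity — while the bad pairs converge, uniformly on `B(0, R)` at `s = 0`, to a pair at
  which `W(0, ·)` oscillates by `≥ ε`.

The passage from the duality-class solution `u` of the fact to its representative (KNSS §4,
`KNSS2009_regularity_axisymmetric_swirl_holds`) and conjunct (i) of `leiRenZhang2019_sliding`
are the sequel file; the swirl half (ii) needs the interior gradient estimate for the swirl
equation and is not addressed here.

## Mathlib / tree search

Tree: `IsBoundedWeakNSSolutionOn` and its `mono` (`KNSSLiouville`), `comp_add_right`
(`KNSSRegularityGluing`), `comp_add_space` (`BoundedWeakTranslate`); the descent gadgets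
`exists_smooth_bump_integral_one`, `norm_planarProj_le`, `isTestFunctionOn_bumpLift_scalar`,
`integral_inner_gradient_bumpLift_scalar_eq`, `isSpaceTimeTestOn_bumpLift`, `divergence_bumpLift`,
`integral_bumpLift_pairing_eq` (`KNSSTypeIRateLiouvilleDescent`); `KNSS2009_liouville_planar_holds`
(`KNSSLiouvillePlanarHolds`); `eq_of_ae_restrict_Iio_of_continuousOn` (`KNSSThm52Assembly`);
`eq_of_tendstoLocallyUniformly_of_rot_about` (`KNSSTypeIRateLimit`);
`tendstoLocallyUniformly_of_lipschitz_of_tendsto` (`LeiZhang2011ZoomIn`); `lipschitzWith_clamp`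
(`KNSSTypeIIZoomIn`); `exists_strictMono_tendsto_of_lipschitzWith`, `isWeaklyDivFree_of_tendsto`
pattern (`KNSSBlowupLimit`, `LeiZhang2011BlowupCase2`); `exists_strictMono_tendsto_primitive`,
`isBoundedWeakNSSolutionOn_add_smul_of_tendsto`, `IsWeaklyDivFree.add_const`
(`BoundedWeakDriftLimit`); `rotZ`, `rotZL`, `norm_rotZ`, `IsAxisymmetric`, `swirl`, `cylRadius`,
`eZ`, `exists_rotZ_eq_single_add_smul` (`AxisymmetricEuler`, `AxisymmetricVorticityTransport`,
`KNSSTypeIRateSelection`). Mathlib: `measurable_deriv`, `Metric.tendstoUniformlyOn_iff`,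
`LipschitzWith.dist_le_mul`, `Measure.eq_of_ae_eq`.

## References

* Z. Lei, X. Ren, Q. S. Zhang, *On ancient periodic solutions to axially-symmetric Navier–Stokes
  equations*, arXiv:1902.11229 (§§1–3 and §5 published in Math. Ann. 383 (2022) 415–431), §5,
  Lemma 5.1 "Sliding Property" and its proof (arXiv p. 13). [LeiRenZhang2019]
* Z. Lei, Q. S. Zhang, *A Liouville theorem for the axially-symmetric Navier–Stokes equations*,
  J. Funct. Anal. 261 (2011) 2323–2345 = arXiv:1011.5066, proof of Theorem 1.4, §4, Case 2
  (arXiv pp. 12–13: receding axes, "`|v^θ| ≲ 1/r_k`"). [LeiZhang2011]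
* G. Koch, N. Nadirashvili, G. Seregin, V. Šverák, *Liouville theorems for the Navier–Stokes
  equations and applications*, Acta Math. 203 (2009) 83–105 = arXiv:0709.3599: §4 (ii) p. 8,
  Theorem 5.1 p. 9, proof of Theorem 6.2 p. 13. [KochNadirashviliSereginSverak2009]
-/

noncomputable section

open MeasureTheory Set Function Filter TopologicalSpace Metric WithLp
open _root_.Topology
open scoped RealInnerProductSpace Laplacian NNReal ContDiff

namespace Literature.Analysis.FluidPDE

/-! ### Descent along `e₁` with continuous slices and a measurable trace -/

section Descent

variable {P : EuclideanSpace ℝ (Fin 3) →L[ℝ] EuclideanSpace ℝ (Fin 2)}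
  {L : EuclideanSpace ℝ (Fin 2) →L[ℝ] EuclideanSpace ℝ (Fin 3)}

/-- **Descent of bounded weak solutions along an ignorable coordinate, slice-continuous form**
(the weak class of Koch–Nadirashvili–Seregin–Šverák 2009, §4 (ii), arXiv p. 8; the tree's
`IsBoundedWeakNSSolutionOn.planarTrace_of_lineInvariant` with its joint-continuity hypothesis
split into its two uses). Let `u` be a bounded weak solution of Navier–Stokes with viscosity `ν`
on `ℝ³ × I` whose slices `u(t, ·)`, `t ∈ I`, are continuous, invariant under `x ↦ x + δe₁` and
weakly divergence free, and whose planar trace `V(t, y) = P u(t, L y)` (`P x = (x₀, x₂)`,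
`L y = (y₀, 0, y₁)`) is a.e. strongly measurable on `I × ℝ²`. Then `V` is a bounded weak solution
on `ℝ² × I` (lift planar test fields by a normalised bump in `x₁`; the `ℝ³` pairings equal the
planar ones slice by slice, `integral_inner_gradient_bumpLift_scalar_eq`,
`integral_bumpLift_pairing_eq`). [cite: KochNadirashviliSereginSverak2009, §4 (ii) (arXiv p. 8)] -/
theorem IsBoundedWeakNSSolutionOn.planarProj_trace_of_lineInvariant
    (hP : ∀ v : EuclideanSpace ℝ (Fin 3), P v = toLp 2 ![v 0, v 2])
    (hL : ∀ y : EuclideanSpace ℝ (Fin 2), L y = toLp 2 ![y 0, 0, y 1])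
    {I : Set ℝ} {hI : IsOpen I} {ν : ℝ}
    {u : ℝ → EuclideanSpace ℝ (Fin 3) → EuclideanSpace ℝ (Fin 3)}
    (hu : IsBoundedWeakNSSolutionOn I hI ν u) (huc : ∀ t ∈ I, Continuous (u t))
    (hVm : AEStronglyMeasurable (uncurry fun t y => P (u t (L y))) (volume.restrict (I ×ˢ univ)))
    (hinv : ∀ t ∈ I, ∀ (x : EuclideanSpace ℝ (Fin 3)) (δ : ℝ),
      u t (x + EuclideanSpace.single 1 δ) = u t x)
    (hdiv : ∀ t ∈ I, IsWeaklyDivFree (u t)) :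
    IsBoundedWeakNSSolutionOn I hI ν (fun t y => P (u t (L y))) := by
  obtain ⟨χ, hχ, hχc, hχi, hχ1, hχ'i, hχ', hχ''i, hχ''⟩ := exists_smooth_bump_integral_one
  obtain ⟨-, ⟨C, hC⟩, -, hweak⟩ := hu
  refine ⟨hVm, ⟨C, fun t ht y => (norm_planarProj_le hP _).trans (hC t ht (L y))⟩, ?_,
    fun ψ hψ hψdiv => ?_⟩
  · -- weak divergence-freeness of the slices, for every `t ∈ I`
    refine (ae_restrict_iff' hI.measurableSet).2 (Eventually.of_forall fun t ht θ hθ => ?_)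
    have key := hdiv t ht _ (isTestFunctionOn_bumpLift_scalar hP hL hθ hχ hχc)
    rw [integral_inner_gradient_bumpLift_scalar_eq hP hL hθ hχ hχc hχi hχ1 hχ'i hχ' (huc t ht)
      (fun x => hC t ht x) (hinv t ht)] at key
    exact key
  · -- the weak identity
    have hΨ := isSpaceTimeTestOn_bumpLift (I := I) (hI := hI) hP hL hψ hχ hχc
    have hΨdiv : ∀ t, VectorCalculus.IsDivFree
        ((fun t (x : EuclideanSpace ℝ (Fin 3)) => χ (x 1) • L (ψ t (P x))) t) := by
      intro t x
      have hψ2 : ContDiff ℝ 2 (ψ t) := contDiff_infty.1 (hψ.contDiff_slice t) 2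
      have hχ2 : ContDiff ℝ 2 χ := contDiff_infty.1 hχ 2
      change VectorCalculus.divergence (fun x : EuclideanSpace ℝ (Fin 3) =>
        χ (x 1) • L (ψ t (P x))) x = 0
      rw [divergence_bumpLift hP hL hχ2 hψ2, hψdiv t (P x), mul_zero]
    have key := hweak _ hΨ hΨdiv
    rw [← key]
    refine (setIntegral_congr_fun hI.measurableSet fun t ht => ?_).symm
    exact integral_bumpLift_pairing_eq hP hL hψ hχ hχc hχi hχ1 hχ'i hχ' hχ''i hχ'' (huc t ht)
      (fun x => hC t ht x) (hinv t ht) ν t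

end Descent

/-! ### KNSS Theorem 5.1 for line-invariant fields with a measurable axial drift -/

section Planar

/-- `e_z` has no horizontal components and unit axial component. [folklore] -/
private theorem eZ_apply_fin3_aux :
    (eZ : EuclideanSpace ℝ (Fin 3)) 0 = 0 ∧ (eZ : EuclideanSpace ℝ (Fin 3)) 1 = 0 ∧
      (eZ : EuclideanSpace ℝ (Fin 3)) 2 = 1 := by
  refine ⟨?_, ?_, ?_⟩ <;> simp [eZ]

/-- **The planar components of a line-invariant bounded ancient weak solution with a measurable
axial drift are constant in space** (KNSS 2009, Theorem 5.1 through the slice-continuous descent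
lemma; the form needed for limits of translates of the §4 representative `U + β(t)e_z`, whose
limit drift is only measurable). Let `W + c(t) e_z` be a bounded weak solution of Navier–Stokes
(`ν = 1`) on `ℝ³ × (−∞, 0)` with `W` jointly continuous, invariant under `x ↦ x + δe₁` and with
weakly divergence-free slices for `t < 0`, and `c` measurable. Then for **every** `t < 0` and
every `x`, `W₀(t, x) = W₀(t, 0)` and `W₂(t, x) = W₂(t, 0)`: the planar trace of `W + c e_z` is a
bounded weak solution on `ℝ² × (−∞, 0)` (`planarProj_trace_of_lineInvariant`), hence equal to
`b(t)` a.e. for a.e. `t` by Theorem 5.1 (`KNSS2009_liouville_planar_holds`), i.e.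
`W₀(t, L y) = b₀(t)`, `W₂(t, L y) = b₁(t) − c(t)` a.e.; continuity in `y`, the invariance and
continuity in `t` upgrade this to every `(t, x)`. [cite: KochNadirashviliSereginSverak2009, Thm 5.1 (arXiv p. 9) and proof of Thm 6.2 (p. 13)] -/
theorem planar_apply_eq_of_lineInvariant_add_drift
    {W : ℝ → EuclideanSpace ℝ (Fin 3) → EuclideanSpace ℝ (Fin 3)} {c : ℝ → ℝ}
    (hw : IsBoundedWeakNSSolutionOn (Iio 0) isOpen_Iio 1 (fun t x => W t x + c t • eZ))
    (hW : Continuous (uncurry W)) (hc : Measurable c)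
    (hinv : ∀ t < 0, ∀ (x : EuclideanSpace ℝ (Fin 3)) (δ : ℝ),
      W t (x + EuclideanSpace.single 1 δ) = W t x)
    (hdiv : ∀ t < 0, IsWeaklyDivFree (W t)) :
    ∀ t < 0, ∀ x : EuclideanSpace ℝ (Fin 3), W t x 0 = W t 0 0 ∧ W t x 2 = W t 0 2 := by
  obtain ⟨he0, he1, he2⟩ := eZ_apply_fin3_aux
  -- the gadgets
  set P : EuclideanSpace ℝ (Fin 3) →L[ℝ] EuclideanSpace ℝ (Fin 2) :=
    (EuclideanSpace.proj (0 : Fin 3)).smulRight (EuclideanSpace.single (0 : Fin 2) (1 : ℝ)) +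
      (EuclideanSpace.proj (2 : Fin 3)).smulRight (EuclideanSpace.single (1 : Fin 2) (1 : ℝ))
    with hPdef
  set L : EuclideanSpace ℝ (Fin 2) →L[ℝ] EuclideanSpace ℝ (Fin 3) :=
    (EuclideanSpace.proj (0 : Fin 2)).smulRight (EuclideanSpace.single (0 : Fin 3) (1 : ℝ)) +
      (EuclideanSpace.proj (1 : Fin 2)).smulRight (EuclideanSpace.single (2 : Fin 3) (1 : ℝ))
    with hLdef
  have hP : ∀ v : EuclideanSpace ℝ (Fin 3), P v = toLp 2 ![v 0, v 2] := by
    intro v; rw [hPdef]; ext j; fin_cases j <;> simp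
  have hL : ∀ y : EuclideanSpace ℝ (Fin 2), L y = toLp 2 ![y 0, 0, y 1] := by
    intro y; rw [hLdef]; ext j; fin_cases j <;> simp
  -- the field `w = W + c e_z` and its slices
  set w : ℝ → EuclideanSpace ℝ (Fin 3) → EuclideanSpace ℝ (Fin 3) := fun t x => W t x + c t • eZ
    with hwdef
  have hWsl : ∀ t, Continuous (W t) := fun t => hW.comp (Continuous.prodMk_right t)
  have hwc : ∀ t ∈ Iio (0 : ℝ), Continuous (w t) := fun t _ =>
    (hWsl t).add continuous_const
  have hwinv : ∀ t ∈ Iio (0 : ℝ), ∀ (x : EuclideanSpace ℝ (Fin 3)) (δ : ℝ),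
      w t (x + EuclideanSpace.single 1 δ) = w t x := by
    intro t ht x δ
    simp only [hwdef, hinv t ht x δ]
  have hwdiv : ∀ t ∈ Iio (0 : ℝ), IsWeaklyDivFree (w t) := fun t ht =>
    (hdiv t ht).add_const _
  -- measurability of the planar trace: `P (W(t, L y)) + c t • P e_z`
  have hVm : AEStronglyMeasurable (uncurry fun t y => P (w t (L y)))
      (volume.restrict (Iio (0 : ℝ) ×ˢ univ)) := by
    have h1 : Measurable (uncurry fun t (y : EuclideanSpace ℝ (Fin 2)) => P (w t (L y))) := by
      have hWm : Measurable fun p : ℝ × EuclideanSpace ℝ (Fin 2) => W p.1 (L p.2) :=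
        (hW.comp (continuous_fst.prodMk (L.continuous.comp continuous_snd))).measurable
      have hcm : Measurable fun p : ℝ × EuclideanSpace ℝ (Fin 2) => c p.1 • (eZ : EuclideanSpace ℝ (Fin 3)) :=
        (hc.comp measurable_fst).smul_const _
      have : (uncurry fun t (y : EuclideanSpace ℝ (Fin 2)) => P (w t (L y))) =
          fun p => P (W p.1 (L p.2) + c p.1 • eZ) := by
        funext p; rfl
      rw [this]
      exact P.continuous.measurable.comp (hWm.add hcm)
    exact h1.aestronglyMeasurable
  -- descent to the plane and Theorem 5.1
  have hV := hw.planarProj_trace_of_lineInvariant hP hL hwc hVm hwinv hwdiv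
  obtain ⟨b, -, -, hb⟩ := KNSS2009_liouville_planar_holds hV
  -- for a.e. `t`: the planar components of `W` are constant on the plane `x₁ = 0`, hence everywhere
  have hae : ∀ᵐ t ∂((volume : Measure ℝ).restrict (Iio 0)),
      ∀ x : EuclideanSpace ℝ (Fin 3), W t x 0 - W t 0 0 = 0 ∧ W t x 2 - W t 0 2 = 0 := by
    filter_upwards [hb, ae_restrict_mem measurableSet_Iio] with t ht htneg
    have htneg : t < 0 := htneg
    -- componentwise a.e. identities on the plane
    have h0 : (fun y : EuclideanSpace ℝ (Fin 2) => W t (L y) 0) =ᵐ[volume] fun _ => b t 0 := by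
      filter_upwards [ht] with y hy
      have := congr_arg (fun v : EuclideanSpace ℝ (Fin 2) => v 0) hy
      simpa [hP, hwdef, he0] using this
    have h2 : (fun y : EuclideanSpace ℝ (Fin 2) => W t (L y) 2) =ᵐ[volume]
        fun _ => b t 1 - c t := by
      filter_upwards [ht] with y hy
      have := congr_arg (fun v : EuclideanSpace ℝ (Fin 2) => v 1) hy
      simp only [hP, hwdef] at this
      have h' : W t (L y) 2 + c t = b t 1 := by simpa [he2] using this
      linarith
    -- continuity upgrades them to every `y`
    have hc0 : Continuous fun y : EuclideanSpace ℝ (Fin 2) => W t (L y) 0 :=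
      (EuclideanSpace.proj (0 : Fin 3)).continuous.comp ((hWsl t).comp L.continuous)
    have hc2 : Continuous fun y : EuclideanSpace ℝ (Fin 2) => W t (L y) 2 :=
      (EuclideanSpace.proj (2 : Fin 3)).continuous.comp ((hWsl t).comp L.continuous)
    have e0 := Measure.eq_of_ae_eq h0 hc0 continuous_const
    have e2 := Measure.eq_of_ae_eq h2 hc2 continuous_const
    -- every `x` is a translate along `e₁` of a point of the plane
    have key : ∀ x : EuclideanSpace ℝ (Fin 3), W t x = W t (L (toLp 2 ![x 0, x 2])) := by
      intro x
      have hx : L (toLp 2 ![x 0, x 2]) + EuclideanSpace.single 1 (x 1) = x := by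
        rw [hL]; ext j; fin_cases j <;> simp
      conv_lhs => rw [← hx]
      exact hinv t htneg _ _
    have key0 : L (toLp 2 ![(0 : EuclideanSpace ℝ (Fin 3)) 0, (0 : EuclideanSpace ℝ (Fin 3)) 2]) = 0 := by
      rw [hL]; ext j; fin_cases j <;> simp
    intro x
    refine ⟨?_, ?_⟩
    · rw [key x, key 0]
      have a := congr_fun e0 (toLp 2 ![x 0, x 2])
      have a0 := congr_fun e0 (toLp 2 ![(0 : EuclideanSpace ℝ (Fin 3)) 0, (0 : EuclideanSpace ℝ (Fin 3)) 2])
      simp only at a a0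
      rw [a, a0, sub_self]
    · rw [key x, key 0]
      have a := congr_fun e2 (toLp 2 ![x 0, x 2])
      have a0 := congr_fun e2 (toLp 2 ![(0 : EuclideanSpace ℝ (Fin 3)) 0, (0 : EuclideanSpace ℝ (Fin 3)) 2])
      simp only at a a0
      rw [a, a0, sub_self]
  -- continuity in `t` upgrades "a.e. `t`" to every `t < 0`
  intro t ht x
  have hline : ∀ (z : EuclideanSpace ℝ (Fin 3)) (i : Fin 3), Continuous fun s => W s z i :=
    fun z i => (EuclideanSpace.proj i).continuous.comp (hW.comp (continuous_id.prodMk continuous_const))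
  have hcont : ∀ i : Fin 3, ContinuousOn (fun s => W s x i - W s 0 i) (Iio 0) := fun i =>
    ((hline x i).sub (hline 0 i)).continuousOn
  refine ⟨sub_eq_zero.1 (eq_of_ae_restrict_Iio_of_continuousOn (hcont 0)
      (hae.mono fun s hs => (hs x).1) ht),
    sub_eq_zero.1 (eq_of_ae_restrict_Iio_of_continuousOn (hcont 2)
      (hae.mono fun s hs => (hs x).2) ht)⟩

end Planar

/-! ### The tangential component is small far from the axis -/

section Tangential

/-- **`|v_θ| ≲ 1/r` from a swirl bound** (Lei–Zhang 2011, proof of Theorem 1.4, §4, Case 2,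
arXiv p. 12: "`|v^θ(t, y)| ≲ 1/r_k` for `y ∈ B(x_k, r_k/2)`"; here in Cartesian form on the meridian
side `{x₀ > 0}`): if
`|Γ(x)| = |x₀ v₁(x) − x₁ v₀(x)| ≤ C₁` and `‖v‖ ≤ M₀` everywhere, then
`|v₁(x)| ≤ (C₁ + |x₁| M₀) / x₀` wherever `x₀ > 0`. [cite: LeiZhang2011, proof of Thm 1.4, §4 Case 2 (arXiv p. 12)] -/
theorem abs_apply_one_le_of_abs_swirl_le
    {v : EuclideanSpace ℝ (Fin 3) → EuclideanSpace ℝ (Fin 3)} {C₁ M₀ : ℝ}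
    (hsw : ∀ x, |swirl v x| ≤ C₁) (hbd : ∀ x, ‖v x‖ ≤ M₀) {x : EuclideanSpace ℝ (Fin 3)}
    (hx : 0 < x 0) : |v x 1| ≤ (C₁ + |x 1| * M₀) / x 0 := by
  have hsw' : swirl v x = x 0 * v x 1 - x 1 * v x 0 := rfl
  have hx0 : x 0 ≠ 0 := hx.ne'
  have h1 : v x 1 = (swirl v x + x 1 * v x 0) / x 0 := by
    rw [hsw']; field_simp; ring
  have hv0 : |v x 0| ≤ M₀ :=
    calc |v x 0| = ‖v x 0‖ := (Real.norm_eq_abs _).symm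
      _ ≤ ‖v x‖ := PiLp.norm_apply_le (v x) 0
      _ ≤ M₀ := hbd x
  rw [h1, abs_div, abs_of_pos hx]
  refine div_le_div_of_nonneg_right ?_ hx.le
  calc |swirl v x + x 1 * v x 0| ≤ |swirl v x| + |x 1 * v x 0| := abs_add_le _ _
    _ ≤ C₁ + |x 1| * M₀ := by
        rw [abs_mul]
        exact add_le_add (hsw x) (mul_le_mul_of_nonneg_left hv0 (abs_nonneg _))

end Tangential

/-! ### Far-field flattening of the velocity of the regular representative -/

section FarField

/-- A space–time field with `‖V(t, x) − V(s, y)‖ ≤ K₀ (|t − s| + ‖x − y‖)` on `S × ℝ³` is jointly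
continuous there. [folklore] -/
private theorem continuousOn_uncurry_of_lip_aux {S : Set ℝ}
    {V : ℝ → EuclideanSpace ℝ (Fin 3) → EuclideanSpace ℝ (Fin 3)} {K₀ : ℝ}
    (h : ∀ s ∈ S, ∀ t ∈ S, ∀ x y : EuclideanSpace ℝ (Fin 3),
      ‖V t x - V s y‖ ≤ K₀ * (|t - s| + ‖x - y‖)) :
    ContinuousOn (uncurry V) (S ×ˢ univ) := by
  intro p hp
  rw [ContinuousWithinAt, Metric.tendsto_nhdsWithin_nhds]
  intro ε hε
  set δ : ℝ := ε / (2 * (|K₀| + 1)) with hδ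
  have hδpos : 0 < δ := by positivity
  refine ⟨δ, hδpos, fun q hq hqp => ?_⟩
  have hd : max (dist q.1 p.1) (dist q.2 p.2) < δ := by rwa [← Prod.dist_eq]
  have hq1 : |q.1 - p.1| < δ := by
    have := (le_max_left _ _).trans_lt hd; rwa [Real.dist_eq] at this
  have hq2 : ‖q.2 - p.2‖ < δ := by
    have := (le_max_right _ _).trans_lt hd; rwa [dist_eq_norm] at this
  rw [dist_eq_norm]
  show ‖V q.1 q.2 - V p.1 p.2‖ < ε
  calc ‖V q.1 q.2 - V p.1 p.2‖ ≤ K₀ * (|q.1 - p.1| + ‖q.2 - p.2‖) := h p.1 hp.1 q.1 hq.1 q.2 p.2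
    _ ≤ |K₀| * (|q.1 - p.1| + ‖q.2 - p.2‖) :=
        mul_le_mul_of_nonneg_right (le_abs_self _) (by positivity)
    _ ≤ |K₀| * (δ + δ) := by gcongr
    _ < (|K₀| + 1) * (δ + δ) := mul_lt_mul_of_pos_right (lt_add_one _) (by positivity)
    _ = ε := by rw [hδ]; field_simp; ring

/-- Geometry of the receding axis: for a point `p` of the meridian plane `{x₁ = 0}` and
`a = −p₀ e₁` (the axis seen from `p`), `p + (a + R_θ(y − a)) = R_θ(p + y)`. [folklore] -/
private theorem meridian_add_rot_about_aux {p : EuclideanSpace ℝ (Fin 3)} (hp : p 1 = 0) (θ : ℝ)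
    (y : EuclideanSpace ℝ (Fin 3)) :
    p + (EuclideanSpace.single 0 (-(p 0)) +
        rotZ θ (y - EuclideanSpace.single 0 (-(p 0)))) = rotZ θ (p + y) := by
  ext i
  fin_cases i <;> simp [hp, -mul_eq_mul_left_iff, -mul_eq_mul_right_iff] <;> ring

/-- Rotations about the axis preserve distances: `‖R_θ a − R_θ b‖ = ‖a − b‖`. [folklore] -/
private theorem norm_rotZ_sub_rotZ_aux (θ : ℝ) (a b : EuclideanSpace ℝ (Fin 3)) :
    ‖rotZ θ a - rotZ θ b‖ = ‖a - b‖ := by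
  rw [← rotZL_apply, ← rotZL_apply, ← map_sub, rotZL_apply, norm_rotZ]

/-- **The contradiction of the sliding argument, bad centres on the meridian half-plane**
(Lei–Ren–Zhang 2019, proof of Lemma 5.1; centres `p_n` with `(p_n)₁ = 0`, `(p_n)₀ → ∞`, times
`t_n < 0`, and pairs `x_n, y_n ∈ B(p_n, R)` with `‖U(t_n, x_n) − U(t_n, y_n)‖ > ε`). [cite: LeiRenZhang2019, proof of Lemma 5.1 (arXiv p. 13); LeiZhang2011, proof of Thm 1.4, §4 Case 2 (arXiv pp. 12–13)] -/
private theorem farField_false_of_meridian_aux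
    {U : ℝ → EuclideanSpace ℝ (Fin 3) → EuclideanSpace ℝ (Fin 3)} {β : ℝ → ℝ}
    {M K L C₁ C R ε : ℝ}
    (hsol : IsBoundedWeakNSSolutionOn (Iio 0) isOpen_Iio 1 (fun t x => U t x + β t • eZ))
    (hUM : ∀ t < 0, ∀ x, ‖U t x‖ ≤ M)
    (hUx : ∀ t < 0, ∀ x y, ‖U t x - U t y‖ ≤ K * ‖x - y‖)
    (hUt : ∀ s < 0, ∀ t < 0, ∀ x, ‖U t x - U s x‖ ≤ L * |t - s|)
    (haxi : ∀ t < 0, IsAxisymmetric (U t))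
    (hsw : ∀ t < 0, ∀ x, |swirl (U t) x| ≤ C₁)
    (hdiv : ∀ t < 0, IsWeaklyDivFree (U t))
    (hβm : Measurable β) (hβC : ∀ t, |β t| ≤ C) (hε : 0 < ε)
    {tn : ℕ → ℝ} {pn xn yn : ℕ → EuclideanSpace ℝ (Fin 3)} (htn : ∀ n, tn n < 0)
    (hp1 : ∀ n, pn n 1 = 0) (hp0 : Tendsto (fun n => pn n 0) atTop atTop)
    (hxn : ∀ n, xn n ∈ ball (pn n) R) (hyn : ∀ n, yn n ∈ ball (pn n) R)
    (hbad : ∀ n, ε < ‖U (tn n) (xn n) - U (tn n) (yn n)‖) : False := by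
  -- constants
  set K₀ : ℝ := max (max K L) 1 with hK₀
  have hK₀1 : 1 ≤ K₀ := le_max_right _ _
  have hK₀pos : 0 < K₀ := one_pos.trans_le hK₀1
  have hK2 : 0 ≤ 2 * K₀ := by positivity
  have hKK₀ : K ≤ K₀ := (le_max_left _ _).trans (le_max_left _ _)
  have hLK₀ : L ≤ K₀ := (le_max_right _ _).trans (le_max_left _ _)
  -- the time intervals `(A n, 0)`, `A n → -∞`
  set A : ℕ → ℝ := fun n => -((n : ℝ) + 2) with hA
  have hA1 : ∀ n, A n + 1 ≤ 0 := fun n => by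
    have h := (Nat.cast_nonneg n : (0 : ℝ) ≤ n)
    simp only [hA]; linarith
  have hAtend : Tendsto A atTop atBot :=
    tendsto_neg_atTop_atBot.comp (tendsto_natCast_atTop_atTop.atTop_add tendsto_const_nhds)
  -- the translates `V n (s, y) = U (t_n + s, p_n + y)` and the translated drifts
  set V : ℕ → ℝ → EuclideanSpace ℝ (Fin 3) → EuclideanSpace ℝ (Fin 3) :=
    fun n s y => U (s + tn n) (pn n + y) with hV
  set βn : ℕ → ℝ → ℝ := fun n s => β (s + tn n) with hβn
  have hneg : ∀ n, ∀ s : ℝ, s ≤ 0 → s + tn n < 0 := fun n s hs => by linarith [htn n]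
  have hVsol : ∀ n, IsBoundedWeakNSSolutionOn (Ioo (A n) 0) isOpen_Ioo 1
      (fun s y => V n s y + βn n s • eZ) := by
    intro n
    have h1 := (hsol.comp_add_right (tn n) (J := Iio (-tn n)) isOpen_Iio (fun t => by
      simp only [mem_Iio]; constructor <;> intro h <;> linarith)).comp_add_space (pn n)
    exact h1.mono isOpen_Ioo fun s hs => by
      simp only [mem_Iio]; linarith [hs.2, htn n]
  have hVbd : ∀ n, ∀ s : ℝ, s ≤ 0 → ∀ y, ‖V n s y‖ ≤ M := fun n s hs y => hUM _ (hneg n s hs) _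
  have hVlipx : ∀ n, ∀ s : ℝ, s ≤ 0 → ∀ x y, ‖V n s x - V n s y‖ ≤ K₀ * ‖x - y‖ := by
    intro n s hs x y
    calc ‖V n s x - V n s y‖ ≤ K * ‖(pn n + x) - (pn n + y)‖ := hUx _ (hneg n s hs) _ _
      _ = K * ‖x - y‖ := by rw [add_sub_add_left_eq_sub]
      _ ≤ K₀ * ‖x - y‖ := mul_le_mul_of_nonneg_right hKK₀ (norm_nonneg _)
  have hVlip : ∀ n, ∀ s : ℝ, s ≤ 0 → ∀ t : ℝ, t ≤ 0 → ∀ x y,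
      ‖V n t x - V n s y‖ ≤ K₀ * (|t - s| + ‖x - y‖) := by
    intro n s hs t ht x y
    calc ‖V n t x - V n s y‖ ≤ ‖V n t x - V n s x‖ + ‖V n s x - V n s y‖ :=
          norm_sub_le_norm_sub_add_norm_sub _ _ _
      _ ≤ L * |(t + tn n) - (s + tn n)| + K₀ * ‖x - y‖ :=
          add_le_add (hUt _ (hneg n s hs) _ (hneg n t ht) _) (hVlipx n s hs x y)
      _ = L * |t - s| + K₀ * ‖x - y‖ := by rw [add_sub_add_right_eq_sub]
      _ ≤ K₀ * |t - s| + K₀ * ‖x - y‖ := by gcongr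
      _ = K₀ * (|t - s| + ‖x - y‖) := by ring
  have hVcont : ∀ n, ContinuousOn (uncurry (V n)) (Ioo (A n) 0 ×ˢ univ) := fun n =>
    continuousOn_uncurry_of_lip_aux fun s hs t ht x y => hVlip n s hs.2.le t ht.2.le x y
  have hVdiv : ∀ n, ∀ s ∈ Ioo (A n) 0, IsWeaklyDivFree (V n s) := by
    intro n s hs
    have h1 := (hdiv _ (hneg n s hs.2.le)).comp_sub_right (-(pn n))
    have e : (fun y => U (s + tn n) (y - -pn n)) = V n s := by
      funext y
      show U (s + tn n) (y - -pn n) = U (s + tn n) (pn n + y)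
      rw [sub_neg_eq_add, add_comm y]
    rw [e] at h1
    exact h1
  -- symmetry about the receding axes, and the tangential component
  have hVsym : ∀ n, ∀ s : ℝ, s ≤ 0 → ∀ (θ : ℝ) (y : EuclideanSpace ℝ (Fin 3)),
      V n s (EuclideanSpace.single 0 (-(pn n 0)) +
        rotZ θ (y - EuclideanSpace.single 0 (-(pn n 0)))) = rotZ θ (V n s y) := by
    intro n s hs θ y
    show U (s + tn n) (pn n + (EuclideanSpace.single 0 (-(pn n 0)) +
        rotZ θ (y - EuclideanSpace.single 0 (-(pn n 0))))) = rotZ θ (U (s + tn n) (pn n + y))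
    rw [meridian_add_rot_about_aux (hp1 n), haxi _ (hneg n s hs)]
  have hVtan : ∀ n, ∀ s : ℝ, s ≤ 0 → ∀ y : EuclideanSpace ℝ (Fin 3), -(y 0) < pn n 0 →
      |V n s y 1| ≤ (C₁ + |y 1| * M) / (pn n 0 + y 0) := by
    intro n s hs y hy
    have e1 : (pn n + y) 1 = y 1 := by simp [hp1 n]
    have e0 : (pn n + y) 0 = pn n 0 + y 0 := by simp
    have hx0 : 0 < (pn n + y) 0 := by rw [e0]; linarith
    have h := abs_apply_one_le_of_abs_swirl_le (hsw _ (hneg n s hs)) (hUM _ (hneg n s hs)) hx0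
    rw [e1, e0] at h
    exact h
  -- uniform Lipschitz bound and pointwise Arzelà–Ascoli for the clamped maps
  set Wc : ℕ → ℝ × EuclideanSpace ℝ (Fin 3) → EuclideanSpace ℝ (Fin 3) :=
    fun n z => V n (max (A n + 1) (min z.1 0)) z.2 with hWc
  have hclamp0 : ∀ n (r : ℝ), max (A n + 1) (min r 0) ≤ 0 := fun n r =>
    max_le (hA1 n) (min_le_right _ _)
  have hWclip : ∀ n, LipschitzWith (Real.toNNReal (2 * K₀)) (Wc n) := fun n =>
    lipschitzWith_clamp hK₀pos.le (hA1 n) fun s hs t ht x y => hVlip n s hs.2 t ht.2 x y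
  have hWcball : ∀ n z, Wc n z ∈ closedBall (0 : EuclideanSpace ℝ (Fin 3)) M := fun n z =>
    mem_closedBall_zero_iff.2 (hVbd n _ (hclamp0 n z.1) z.2)
  obtain ⟨φ, Winf, hφ, hWinflip, hWinfball, hWconv⟩ :=
    exists_strictMono_tendsto_of_lipschitzWith Wc hWclip hWcball
  -- a further subsequence along which the primitives of the translated drifts converge
  have hβnm : ∀ n, Measurable (βn n) := fun n => hβm.comp (measurable_id.add_const _)
  have hβnC : ∀ n s, |βn n s| ≤ C := fun n s => hβC _
  obtain ⟨ψ, B, hψ, hB⟩ := exists_strictMono_tendsto_primitive (β := fun k => βn (φ k))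
    (fun k => hβnm _) (fun k s => hβnC _ _)
  have hσt : Tendsto (fun k => φ (ψ k)) atTop atTop := hφ.tendsto_atTop.comp hψ.tendsto_atTop
  have hAσ : Tendsto (fun k => A (φ (ψ k))) atTop atBot := hAtend.comp hσt
  have hevA : ∀ t : ℝ, ∀ᶠ k in atTop, A (φ (ψ k)) + 1 ≤ t := fun t =>
    (hAσ.eventually (eventually_le_atBot (t - 1))).mono fun k hk => by linarith
  -- the limit field
  set W : ℝ → EuclideanSpace ℝ (Fin 3) → EuclideanSpace ℝ (Fin 3) := fun t x => Winf (t, x)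
    with hWdef
  have hWcont : Continuous (uncurry W) := hWinflip.continuous
  have hWM : ∀ t x, ‖W t x‖ ≤ M := fun t x => mem_closedBall_zero_iff.1 (hWinfball (t, x))
  have hWL : ∀ x s t, ‖W t x - W s x‖ ≤ (2 * K₀) * |t - s| := by
    intro x s t
    have h := hWinflip.dist_le_mul (t, x) (s, x)
    simp only [Prod.dist_eq, dist_self, Real.dist_eq, Real.coe_toNNReal _ hK2,
      max_eq_left (abs_nonneg (t - s))] at h
    rwa [dist_eq_norm] at h
  have hVlim : ∀ t : ℝ, t ≤ 0 → ∀ x, Tendsto (fun k => V (φ (ψ k)) t x) atTop (𝓝 (W t x)) := by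
    intro t ht x
    refine ((hWconv (t, x)).comp hψ.tendsto_atTop).congr' ((hevA t).mono fun k hk => ?_)
    show Wc (φ (ψ k)) (t, x) = V (φ (ψ k)) t x
    simp only [hWc]
    rw [min_eq_left ht, max_eq_right hk]
  -- the limit `W + B'(t) e_z` is a bounded weak ancient solution with divergence-free slices
  have hWweak : IsBoundedWeakNSSolutionOn (Iio 0) isOpen_Iio 1
      (fun t x => W t x + deriv B t • eZ) :=
    isBoundedWeakNSSolutionOn_add_smul_of_tendsto (A := fun k => A (φ (ψ k)))
      (U := fun k => V (φ (ψ k))) (β := fun k => βn (φ (ψ k))) hAσ (fun k => hVsol _)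
      (fun k => hVcont _) (fun k t ht x => hVbd _ t ht.2.le x) (fun k t ht => hVdiv _ t ht)
      (fun k => hβnm _) (fun k s => hβnC _ _) hWcont hWM hWL (fun t ht x => hVlim t ht.le x) hB
  have hWdiv : ∀ t < 0, IsWeaklyDivFree (W t) :=
    isWeaklyDivFree_of_tendsto (M := M) (A := fun k => A (φ (ψ k))) (V := fun k => V (φ (ψ k)))
      hAσ (fun k t ht => hVdiv _ t ht) (fun k => hVcont _) (fun k t ht y => hVbd _ t ht.2.le y)
      fun t ht x => hVlim t ht.le x
  -- at a fixed `t ≤ 0`: the shifted slices converge locally uniformly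
  have hshift : ∀ t : ℝ, t ≤ 0 → ∃ k₀ : ℕ, (∀ k, A (φ (ψ (k + k₀))) + 1 ≤ t) ∧
      TendstoLocallyUniformly (fun k => V (φ (ψ (k + k₀))) t) (W t) atTop ∧
      ∀ r : ℝ, TendstoUniformlyOn (fun k => V (φ (ψ (k + k₀))) t) (W t) atTop
        (closedBall (0 : EuclideanSpace ℝ (Fin 3)) r) := by
    intro t ht
    obtain ⟨k₀, hk₀⟩ := eventually_atTop.1 (hevA t)
    have hAk : ∀ k, A (φ (ψ (k + k₀))) + 1 ≤ t := fun k => hk₀ (k + k₀) (by omega)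
    have hconvpt : ∀ x, Tendsto (fun k => V (φ (ψ (k + k₀))) t x) atTop (𝓝 (W t x)) :=
      fun x => (hVlim t ht x).comp (tendsto_add_atTop_nat k₀)
    exact ⟨k₀, hAk, tendstoLocallyUniformly_of_lipschitz_of_tendsto hK₀pos
      (fun k x y => hVlipx _ t ht x y) hconvpt⟩
  -- invariance along `e₁`: the axes recede
  have hWinv : ∀ t < 0, ∀ (x : EuclideanSpace ℝ (Fin 3)) (δ : ℝ),
      W t (x + EuclideanSpace.single 1 δ) = W t x := by
    intro t ht x δ
    obtain ⟨k₀, -, hLU, -⟩ := hshift t ht.le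
    have hRk : Tendsto (fun k => pn (φ (ψ (k + k₀))) 0) atTop atTop :=
      hp0.comp (hσt.comp (tendsto_add_atTop_nat k₀))
    exact eq_of_tendstoLocallyUniformly_of_rot_about hRk
      (fun k θ y => hVsym _ t ht.le θ y) hLU (hWcont.comp (Continuous.prodMk_right t)) x δ
  -- the tangential component vanishes in the limit (all `t ≤ 0`)
  have hWtan : ∀ t : ℝ, t ≤ 0 → ∀ x : EuclideanSpace ℝ (Fin 3), W t x 1 = 0 := by
    intro t ht x
    have hRk : Tendsto (fun k => pn (φ (ψ k)) 0) atTop atTop := hp0.comp hσt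
    have hlim1 : Tendsto (fun k => |V (φ (ψ k)) t x 1|) atTop (𝓝 |W t x 1|) :=
      (((PiLp.continuous_apply 2 _ 1).tendsto _).comp (hVlim t ht x)).abs
    have hbound : Tendsto (fun k => (C₁ + |x 1| * M) / (pn (φ (ψ k)) 0 + x 0)) atTop (𝓝 0) :=
      Tendsto.div_atTop tendsto_const_nhds (tendsto_atTop_add_const_right _ (x 0) hRk)
    have hev : ∀ᶠ k in atTop,
        |V (φ (ψ k)) t x 1| ≤ (C₁ + |x 1| * M) / (pn (φ (ψ k)) 0 + x 0) := by
      filter_upwards [hRk.eventually (eventually_gt_atTop (-(x 0)))] with k hk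
      exact hVtan _ t ht x hk
    exact abs_nonpos_iff.1 (le_of_tendsto_of_tendsto hlim1 hbound hev)
  -- Theorem 5.1 with drift: `W(t, ·)` is constant for `t < 0`, and at `t = 0` by continuity
  have hplanar := planar_apply_eq_of_lineInvariant_add_drift hWweak hWcont (measurable_deriv B)
    hWinv hWdiv
  have hWconst : ∀ t < 0, ∀ x : EuclideanSpace ℝ (Fin 3), W t x = W t 0 := by
    intro t ht x
    obtain ⟨h0, h2⟩ := hplanar t ht x
    ext i
    fin_cases i
    · exact h0
    · show W t x 1 = W t 0 1
      rw [hWtan t ht.le x, hWtan t ht.le 0]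
    · exact h2
  have hW0 : ∀ x : EuclideanSpace ℝ (Fin 3), W 0 x = W 0 0 := by
    intro x
    have hline : ∀ z : EuclideanSpace ℝ (Fin 3), Continuous fun s => W s z := fun z =>
      hWcont.comp (continuous_id.prodMk continuous_const)
    have hg : Continuous fun s => W s x - W s 0 := (hline x).sub (hline 0)
    have h1 : Tendsto (fun s => W s x - W s 0) (𝓝[<] (0 : ℝ)) (𝓝 (W 0 x - W 0 0)) :=
      hg.continuousAt.tendsto.mono_left nhdsWithin_le_nhds
    have h2 : Tendsto (fun s => W s x - W s 0) (𝓝[<] (0 : ℝ)) (𝓝 0) :=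
      tendsto_const_nhds.congr' (eventually_nhdsWithin_of_forall fun s hs => by
        beta_reduce; rw [hWconst s hs x, sub_self])
    exact sub_eq_zero.1 (tendsto_nhds_unique h1 h2)
  -- contradiction at `s = 0`, uniformly on `B(0, R)`
  obtain ⟨k₀, -, -, hU0⟩ := hshift 0 le_rfl
  obtain ⟨k, hk⟩ := eventually_atTop.1 ((Metric.tendstoUniformlyOn_iff.1 (hU0 R)) (ε / 2)
    (half_pos hε))
  have hin : ∀ z : EuclideanSpace ℝ (Fin 3), z ∈ ball (pn (φ (ψ (k + k₀)))) R →
      z - pn (φ (ψ (k + k₀))) ∈ closedBall (0 : EuclideanSpace ℝ (Fin 3)) R := fun z hz => by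
    rw [mem_closedBall_zero_iff, ← dist_eq_norm]
    exact (mem_ball.1 hz).le
  have h1 := hk k le_rfl _ (hin _ (hxn _))
  have h2 := hk k le_rfl _ (hin _ (hyn _))
  have hV1 : V (φ (ψ (k + k₀))) 0 (xn (φ (ψ (k + k₀))) - pn (φ (ψ (k + k₀)))) =
      U (tn (φ (ψ (k + k₀)))) (xn (φ (ψ (k + k₀)))) := by
    simp [hV]
  have hV2 : V (φ (ψ (k + k₀))) 0 (yn (φ (ψ (k + k₀))) - pn (φ (ψ (k + k₀)))) =
      U (tn (φ (ψ (k + k₀)))) (yn (φ (ψ (k + k₀)))) := by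
    simp [hV]
  rw [hW0, hV1] at h1
  rw [hW0, hV2] at h2
  have hlt : ‖U (tn (φ (ψ (k + k₀)))) (xn (φ (ψ (k + k₀)))) -
      U (tn (φ (ψ (k + k₀)))) (yn (φ (ψ (k + k₀))))‖ < ε := by
    rw [← dist_eq_norm]
    calc dist (U (tn (φ (ψ (k + k₀)))) (xn (φ (ψ (k + k₀)))))
          (U (tn (φ (ψ (k + k₀)))) (yn (φ (ψ (k + k₀)))))
        ≤ dist (U (tn (φ (ψ (k + k₀)))) (xn (φ (ψ (k + k₀))))) (W 0 0) +
            dist (W 0 0) (U (tn (φ (ψ (k + k₀)))) (yn (φ (ψ (k + k₀))))) := dist_triangle _ _ _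
      _ < ε / 2 + ε / 2 := add_lt_add (by rwa [dist_comm] at h1) h2
      _ = ε := by ring
  exact lt_irrefl _ ((hbad _).trans hlt)

/-- **Lei–Ren–Zhang 2019, Lemma 5.1 "Sliding Property" (i), for the regular representative.** Let `U + β(t) e_z` be a bounded weak solution of Navier–Stokes
(`ν = 1`) on `ℝ³ × (−∞, 0)` (KNSS 2009, §4 (ii)) where, for `t < 0`, `‖U(t, ·)‖ ≤ M`, `U` is
`K`-Lipschitz in `x` and `L`-Lipschitz in `t`, every slice `U(t, ·)` is axisymmetric and weakly
divergence free with swirl `|Γ| = |x₀U₁ − x₁U₀| ≤ C₁`, and `β` is bounded measurable (the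
output of KNSS §4 for an axisymmetric bounded ancient solution with bounded `|r v_θ|`,
`KNSS2009_regularity_axisymmetric_swirl`). Then `U(t, ·)` **flattens far from the axis,
uniformly in `t < 0`**: for all `R, ε > 0` there is `ρ` such that
`‖U(t, x) − U(t, y)‖ ≤ ε` for every `t < 0`, every centre `x₀` with `r(x₀) ≥ ρ` and all
`x, y ∈ B(x₀, R)`. Proof by contradiction as printed ("Suppose not. Then there exist
`x_k`, `r(x_k) → ∞` … `v(x + x_k, t + t_k)` converges to a bounded ancient solution … invariant in
the `θ` direction, `v_θ → 0` … by the 2D Liouville theorem of [KNSS] it is a constant"): rotate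
the bad centres onto the meridian half-plane by axisymmetry and apply
`farField_false_of_meridian_aux` (Arzelà–Ascoli for the translates, limits of the drifts through
their primitives, receding axes, `planar_apply_eq_of_lineInvariant_add_drift`). [cite: LeiRenZhang2019, Lemma 5.1 and its proof (arXiv p. 13); LeiZhang2011, proof of Thm 1.4, §4 Case 2 (arXiv pp. 12–13)] -/
theorem farField_velocity_osc_of_axisymmetric_add_drift
    {U : ℝ → EuclideanSpace ℝ (Fin 3) → EuclideanSpace ℝ (Fin 3)} {β : ℝ → ℝ}
    {M K L C₁ C : ℝ}
    (hsol : IsBoundedWeakNSSolutionOn (Iio 0) isOpen_Iio 1 (fun t x => U t x + β t • eZ))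
    (hUM : ∀ t < 0, ∀ x, ‖U t x‖ ≤ M)
    (hUx : ∀ t < 0, ∀ x y, ‖U t x - U t y‖ ≤ K * ‖x - y‖)
    (hUt : ∀ s < 0, ∀ t < 0, ∀ x, ‖U t x - U s x‖ ≤ L * |t - s|)
    (haxi : ∀ t < 0, IsAxisymmetric (U t))
    (hsw : ∀ t < 0, ∀ x, |swirl (U t) x| ≤ C₁)
    (hdiv : ∀ t < 0, IsWeaklyDivFree (U t))
    (hβm : Measurable β) (hβC : ∀ t, |β t| ≤ C) :
    ∀ R : ℝ, 0 < R → ∀ ε : ℝ, 0 < ε → ∃ ρ : ℝ, ∀ t < 0, ∀ x₀ : EuclideanSpace ℝ (Fin 3),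
      ρ ≤ cylRadius x₀ → ∀ x ∈ ball x₀ R, ∀ y ∈ ball x₀ R, ‖U t x - U t y‖ ≤ ε := by
  intro R _hR ε hε
  by_contra hcon
  push Not at hcon
  choose tn htn x0 hx0 xn hxn yn hyn hbad using fun n : ℕ => hcon (n : ℝ)
  -- rotate the bad centres onto the meridian half-plane
  choose θ hθ using fun n => exists_rotZ_eq_single_add_smul (x0 n)
  have hp1 : ∀ n, rotZ (θ n) (x0 n) 1 = 0 := fun n => by rw [hθ n]; simp
  have hp0 : ∀ n, rotZ (θ n) (x0 n) 0 = cylRadius (x0 n) := fun n => by rw [hθ n]; simp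
  have hp0t : Tendsto (fun n => rotZ (θ n) (x0 n) 0) atTop atTop := by
    simp only [hp0]
    exact tendsto_atTop_mono (fun n => hx0 n) tendsto_natCast_atTop_atTop
  have hdist : ∀ (φ' : ℝ) (a b : EuclideanSpace ℝ (Fin 3)),
      dist (rotZ φ' a) (rotZ φ' b) = dist a b := fun φ' a b => by
    rw [dist_eq_norm, dist_eq_norm, norm_rotZ_sub_rotZ_aux]
  refine farField_false_of_meridian_aux (R := R) hsol hUM hUx hUt haxi hsw hdiv hβm hβC hε
    (tn := tn) (pn := fun n => rotZ (θ n) (x0 n)) (xn := fun n => rotZ (θ n) (xn n))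
    (yn := fun n => rotZ (θ n) (yn n)) htn hp1 hp0t (fun n => ?_) (fun n => ?_) fun n => ?_
  · rw [mem_ball, hdist]
    exact mem_ball.1 (hxn n)
  · rw [mem_ball, hdist]
    exact mem_ball.1 (hyn n)
  · beta_reduce
    rw [haxi _ (htn n), haxi _ (htn n), norm_rotZ_sub_rotZ_aux]
    exact hbad n

end FarField

end Literature.Analysis.FluidPDE

end
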